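import Literature.AlgebraicGeometry.ModuliOfAbelianVarieties.SiegelFamilyHumbertPairOrder
import HarnessLib

/-!
# Symmetric elements of the order `ℤ[α, β]`, their discriminants `Δ(n + xα + yβ) = S_Δ[x, y]`, and Runge's Cor. 9
# (i) ⟺ (ii): `Δ` is primitively represented by `S_Δ` iff `ℤ[ω] ↪ ℤ[α, β]` optimally (Runge 1999, §6 Cor. 9)

Layer `Literature/AlgebraicGeometry/ModuliOfAbelianVarieties`, namespace
`Literature.AlgebraicGeometry.ModuliOfAbelianVarieties.SiegelModuli`; lane `lit-hodgefound` (Track 2 foundations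
library, Layer A4), seat `lit-hodgefound-skel-4`, row **A4-67**, FILE 3. Sequel of FILE 2 (`SiegelFamilyHumbertPairOrder`:
`R = ℤ[α, β] = ℤ ⊕ ℤα ⊕ ℤβ ⊕ ℤαβ` for `det S_Δ ≠ 0`, `d(R) = det(S_Δ)/4`) and FILE 1 (`SiegelFamilyHumbertTraceForm`:
Runge's `t`, `n`, `Δ` on `ℚ(α, β)`).

## Source followed, verbatim (B. Runge, *Endomorphism rings of abelian surfaces and projective models of their moduli
## spaces*, Tohoku Math. J. 51 (1999), held text `paper:doi-10-2748-tmj-1178224764`, §6 pp. 295–296)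

* **COROLLARY 9.** "For an order `O = ℤ[ω]` of positive discriminant `Δ` with `Δ ≡ 0, 1 (4)` and a discriminant matrix
  `S_Δ` of a QCM-order `R` the following conditions are equivalent: (i) `Δ` is primitively represented by the quadratic
  form `S_Δ`. (ii) There exists an embedding `O ↪ R` such that `R ∩ ℚ(ω) = O`. (iii) A QCM-curve with QCM-order `R` is
  contained in the Humbert surface `H_Δ`. […]"
* Thm. 7 (p. 294): "`R = ℤ ⊕ ℤα ⊕ ℤβ ⊕ ℤαβ`, where `α` and `β` are primitive Rosati invariant elements of positive
  discriminant"; p. 294: "The discriminant form is identically zero on `ℚ`, and hence determines a ternary quadratic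
  form on `A/ℚ`."

## Contents (proved theorems, one auxiliary definition with body; NO named fact, net debt 0)

Here `R = ℤ[α, β] = humbertPairOrder q q′` with `det S_Δ ≠ 0` (FILE 2's basis `(1, α, β, αβ)`), the Rosati involution of
the principal polarisation `x ↦ x′ = E₀⁻¹ ᵗx E₀` (`rosati (typeForm 1)`, rows A2-31/A4-59′; `α′ = α`, `β′ = β`).
* §1 **the Rosati-invariant ("symmetric") elements of `R` are `ℤ ⊕ ℤα ⊕ ℤβ`**: `rosati_comb` (`(c₀ + c₁α + c₂β + c₃αβ)′ =
  c₀ + c₁α + c₂β + c₃βα`), **`rosati_comb_eq_self_iff`** (symmetric ⟺ `c₃ = 0`), `exists_eq_comb_of_rosati_eq_self`, `comb_eq_rosatiMatrix`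
  (`c₀ + xα + yβ = X(c₀, xq + yq′)` — the symmetric elements are the Rosati matrices of the lattice `ℤq + ℤq′` of
  relations); the anti-symmetric line (row A4-66 FILE 4 `rosati_humbertComm`: `γ′ = −γ`): **`rosati_comb_eq_neg_iff`** (`x′ = −x ⟺ 2x = c₃γ`),
  `exists_two_smul_eq_smul_humbertComm` ("`γ` is, up to a rational factor, the unique element with `γ′ = −γ`"),
  `rungeTrace_humbertComm` (`t(γ) = 0`), **`rungeNorm_humbertComm`** (`n(γ) = d`), `humbertComm_mul_self_eq_neg_rungeNorm`
  (`γ² = −n(γ)`).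
* §2 **`Δ(c₀ + xα + yβ) = x²Δ(α) + 2xyΔ(α, β) + y²Δ(β) = S_Δ[x, y]`** (`discForm₂`, `rungeDisc_comb_eq_discForm₂`, `discForm₂_eq_dotProduct`): on symmetric elements
  Runge's ternary form is the binary form `S_Δ` (Humbert's `Δ` on `ℤq + ℤq′`, row A4-66 FILE 1).
* §3 `R ∩ ℚ(ω)` for `ω = n + g(x′α + y′β)`, `g ≠ 0`, `g.c.d.(x′, y′) = 1`: **`map_mem_span_pair_iff`** — an element of `R` lies
  in `ℚ1 + ℚω` iff it is `m + j(x′α + y′β)` with `m, j ∈ ℤ`; hence **`optimal_iff_isUnit`**: `R ∩ ℚ(ω) = ℤ[ω]` (every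
  such element is `m + jω`) iff `g = ±1`.
* §4 **COROLLARY 9 (i) ⟺ (ii) for `R = ℤ[α, β]`** (`runge_cor_nine_i_iff_ii`): `Δ` is primitively represented by `S_Δ`
  (`∃` coprime `(x, y)` with `S_Δ[x, y] = Δ`) iff there is a SYMMETRIC, non-scalar `ω ∈ R` with `Δ(ω) = Δ` and
  `R ∩ ℚ(ω) = ℤ[ω]`.
* §5 `Sp₄(ℤ)`-invariance ("bases up to conjugation by a symplectic matrix … with the same discriminant matrix", p. 296):
  `humbertPolar_humbertVectorConj` (`Δ(q^M, q′^M) = Δ(q, q′)`), **`discMatrix_humbertVectorConj`**,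
  `pairDiscr_humbertVectorConj` (`d` is an orbit invariant), **`conj_mem_humbertPairOrder`**
  (`M⁻¹ ℤ[α, β] M ⊆ ℤ[α^M, β^M]`, from B–W (7) `M⁻¹R₀(q)M = R₀(q^M) + t·1`).
* §6 **the saturation criterion for a general pair** ("By Theorem 2 we may assume …"): `conj_mem_humbertPairOrder_iff`
  (`M⁻¹ ℤ[α, β] M = ℤ[α^M, β^M]`), `conj_mem_humbertPairAlgInt`, **`humbertPairAlgInt_eq_of_conj_normalForm`** (if some
  `M ∈ Sp₄(ℤ)` normalises `q` and `q′^M` has coprime `(d′, e′)`, then `ℚ(α, β) ∩ M₄(ℤ) = ℤ[α, β]`),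
  `humbertPairAlgInt_eq_of_isPrimitiveRel` (row A4-65 supplies `M` for primitive `q`), and then
  **`endRingInt_eq_humbertPairOrder_of_isSimple_of_conj`** / `…_of_finrank_eq_three_of_conj`: `ρ_r(End(X_Z)) = ℤ[α, β]`
  at the simple / `ρ = 3` points of `H_q ∩ H_{q′}` for such a pair (Theorem 7 for these QCM-orders `End(X_Z)`).
* §7 the `𝔥₂`-level half of (i) ⟹ (iii) ("Since `Δ` is represented by `S_Δ`, it follows that `C` is contained in `H_Δ`"):
  `eq_zero_of_smul_add_smul_eq_zero` (`det S_Δ ≠ 0 ⟹ q, q′` independent),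
  **`inter_humbertLocus_subset_humbertLocusOfInvariant(_of_primitively_represented)`**: `H_q ∩ H_{q′} ⊆ H_{S_Δ[x,y]}(𝔥₂)`
  (row A4-59″'s `humbertLocusOfInvariant Δ₀ = ⋃ {H_p : p ≠ 0, Δ(p) = Δ₀}`; primitivity of the vector `xq + yq′` is NOT
  asserted — only `(x, y)` is primitive).

## Scope

* "embedding `O ↪ R`" is read as an embedding by a Rosati-invariant element `ω` (real multiplication by symmetric
  endomorphisms, as in Thm. 9 (ii) / Birkenhake–Wilhelm Cor. 4.6 — the context of the Humbert surface `H_Δ` in (iii));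
  `ℚ(ω)` is `ℚ1 + ℚω` (`ω² = t(ω)ω − n(ω)`, row A4-66 FILE 1 `rosatiMatrix_mul_self`). (iii) and the "Moreover" part
  (components of `H_{Δ(α)} ∩ H_{Δ(β)}`, `GL₂(ℤ)`-classes of `S_Δ`) concern QCM-curves and are NOT formalised (§7 records only
  the inclusion `H_q ∩ H_{q′} ⊆ H_{Δ}(𝔥₂)` for a represented `Δ`); neither is the statement for an abstract QCM-order `R`
  other than `ℤ[α, β]`.

## References

* [Runge1999EndomorphismRingsAbelianSurfaces] B. Runge, *Endomorphism rings of abelian surfaces and projective models of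
  their moduli spaces*, Tohoku Math. J. 51 (1999) 283–303, §6 Thm. 7, Cor. 9 (pp. 294–296).
* [BirkenhakeWilhelm2003] Ch. Birkenhake, H. Wilhelm, *Humbert surfaces and the Kummer plane*, Trans. AMS 355 (2003),
  §4 Lemma 4.1, eq. (9), Cor. 4.6 (pp. 1827–1829).
-/

noncomputable section

open Matrix Module Function

namespace Literature.AlgebraicGeometry.ModuliOfAbelianVarieties

namespace SiegelModuli

open Literature.NumberTheory.Automorphic (siegelUpperHalfSpace)
open Literature.NumberTheory.ModularForms.SiegelUpperHalfSpace
open Literature.Geometry.Kaehler Literature.Geometry.Kaehler.ComplexTorus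
open Sum

/-- `M₄(ℤ)` on the index set `Fin 2 ⊕ Fin 2`. -/
local notation "𝕄ℤ" => Matrix (Fin 2 ⊕ Fin 2) (Fin 2 ⊕ Fin 2) ℤ
/-- `M₄(ℚ)` on the index set `Fin 2 ⊕ Fin 2`. -/
local notation "𝕄" => Matrix (Fin 2 ⊕ Fin 2) (Fin 2 ⊕ Fin 2) ℚ
/-- The Gram matrix `E₀ = (0 1₂; −1₂ 0)` of the principal polarisation. -/
local notation "E₀" => (typeForm (fun _ : Fin 2 ↦ 1) : Matrix (Fin 2 ⊕ Fin 2) (Fin 2 ⊕ Fin 2) ℤ)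

/-! ## §0 Bookkeeping: casts and uniqueness of coordinates -/

section Aux

variable {ι : Type*}

/-- Casting commutes with products. [folklore] -/
private theorem castQ_mul [Fintype ι] (A B : Matrix ι ι ℤ) :
    (A * B).map (Int.cast : ℤ → ℚ) = A.map (Int.cast : ℤ → ℚ) * B.map (Int.cast : ℤ → ℚ) := by
  ext i j; simp [Matrix.mul_apply]

/-- Casting preserves `1`. [folklore] -/
private theorem castQ_one [DecidableEq ι] : (1 : Matrix ι ι ℤ).map (Int.cast : ℤ → ℚ) = 1 := by
  ext i j; simp [Matrix.one_apply]

/-- Casting commutes with integer scalars. [folklore] -/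
private theorem castQ_smul (c : ℤ) (A : Matrix ι ι ℤ) :
    (c • A).map (Int.cast : ℤ → ℚ) = (c : ℚ) • A.map (Int.cast : ℤ → ℚ) := by
  ext i j; simp

/-- Casting commutes with sums. [folklore] -/
private theorem castQ_add (A B : Matrix ι ι ℤ) :
    (A + B).map (Int.cast : ℤ → ℚ) = A.map (Int.cast : ℤ → ℚ) + B.map (Int.cast : ℤ → ℚ) := by
  ext i j; simp

/-- Casting commutes with differences. [folklore] -/
private theorem castQ_sub (A B : Matrix ι ι ℤ) :
    (A - B).map (Int.cast : ℤ → ℚ) = A.map (Int.cast : ℤ → ℚ) - B.map (Int.cast : ℤ → ℚ) := by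
  ext i j; simp

/-- The private copy of `IsUnit (det E₀)` used with the tree's `rosati_mul` / `rosati_one`. [folklore] -/
private theorem isUnit_det_typeForm_one₇ :
    IsUnit (typeForm (fun _ : Fin 2 ↦ 1) : Matrix (Fin 2 ⊕ Fin 2) (Fin 2 ⊕ Fin 2) ℤ).det := by
  rw [typeForm_one_eq_neg_J, Matrix.det_neg, Fintype.card_sum, Fintype.card_fin]
  norm_num
  exact Matrix.isUnit_det_J _ _

end Aux

variable (q q' : Fin 5 → ℤ)

/-- `α = R₀(q)` over `ℚ`. -/
local notation "αℚ" => Matrix.map (humbertRatRep q) (Int.cast : ℤ → ℚ)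
/-- `β = R₀(q′)` over `ℚ`. -/
local notation "βℚ" => Matrix.map (humbertRatRep q') (Int.cast : ℤ → ℚ)

/-- **`R₀` is `ℤ`-linear: `R₀(cq) = c·R₀(q)`** (B–W's (9) is linear in the relation vector). [cite: BirkenhakeWilhelm2003, §4 eq. (9) (p. 1827)] -/
theorem humbertRatRep_smul (c : ℤ) (q : Fin 5 → ℤ) : humbertRatRep (c • q) = c • humbertRatRep q := by
  ext i j
  rcases i with i | i <;> rcases j with j | j <;> fin_cases i <;> fin_cases j <;>
    simp [humbertRatRep, Matrix.smul_apply]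

/-- Uniqueness of rational coordinates in `(1, α, β, αβ)` (`det S_Δ ≠ 0`, FILE 1). [cite: Runge1999EndomorphismRingsAbelianSurfaces, §6 Thm. 7 (p. 294: "`R ⊗ ℚ = ℚ ⊕ ℚα ⊕ ℚβ ⊕ ℚαβ`")] -/
theorem coords_eq_of_comb_eq_rat (hS : humbertInvariant q * humbertInvariant q' ≠ humbertPolar q q' ^ 2)
    {a₀ a₁ a₂ a₃ b₀ b₁ b₂ b₃ : ℚ}
    (h : a₀ • (1 : 𝕄) + a₁ • αℚ + a₂ • βℚ + a₃ • (αℚ * βℚ) = b₀ • (1 : 𝕄) + b₁ • αℚ + b₂ • βℚ + b₃ • (αℚ * βℚ)) :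
    a₀ = b₀ ∧ a₁ = b₁ ∧ a₂ = b₂ ∧ a₃ = b₃ := by
  have li := linearIndependent_humbertPairFam hS
  set c : Fin 4 → ℚ := ![a₀ - b₀, a₁ - b₁, a₂ - b₂, a₃ - b₃] with hc
  have hsum : ∑ i, c i • humbertPairFam q q' i = 0 := by
    have : ∑ i, c i • humbertPairFam q q' i =
        (a₀ • (1 : 𝕄) + a₁ • αℚ + a₂ • βℚ + a₃ • (αℚ * βℚ)) - (b₀ • (1 : 𝕄) + b₁ • αℚ + b₂ • βℚ + b₃ • (αℚ * βℚ)) := by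
      simp only [Fin.sum_univ_four, c, humbertPairFam, Matrix.cons_val_zero, Matrix.cons_val_one, Matrix.cons_val,
        sub_smul]
      abel
    rw [this, h, sub_self]
  have h0 := Fintype.linearIndependent_iff.1 li c hsum
  refine ⟨sub_eq_zero.1 (by simpa [c] using h0 0), sub_eq_zero.1 (by simpa [c] using h0 1),
    sub_eq_zero.1 (by simpa [c] using h0 2), sub_eq_zero.1 (by simpa [c] using h0 3)⟩

/-- Uniqueness of INTEGER coordinates in `(1, α, β, αβ)` (`det S_Δ ≠ 0`, FILE 2). [cite: Runge1999EndomorphismRingsAbelianSurfaces, §6 Thm. 7 (p. 294: "`R = ℤ ⊕ ℤα ⊕ ℤβ ⊕ ℤαβ`")] -/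
theorem coords_eq_of_comb_eq_int (hS : humbertInvariant q * humbertInvariant q' ≠ humbertPolar q q' ^ 2)
    {a₀ a₁ a₂ a₃ b₀ b₁ b₂ b₃ : ℤ}
    (h : a₀ • (1 : 𝕄ℤ) + a₁ • humbertRatRep q + a₂ • humbertRatRep q' + a₃ • (humbertRatRep q * humbertRatRep q') =
      b₀ • (1 : 𝕄ℤ) + b₁ • humbertRatRep q + b₂ • humbertRatRep q' + b₃ • (humbertRatRep q * humbertRatRep q')) :
    a₀ = b₀ ∧ a₁ = b₁ ∧ a₂ = b₂ ∧ a₃ = b₃ := by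
  have h' := congrArg (fun A : 𝕄ℤ ↦ A.map (Int.cast : ℤ → ℚ)) h
  simp only [castQ_add, castQ_smul, castQ_mul, castQ_one] at h'
  obtain ⟨e₀, e₁, e₂, e₃⟩ := coords_eq_of_comb_eq_rat q q' hS h'
  exact ⟨by exact_mod_cast e₀, by exact_mod_cast e₁, by exact_mod_cast e₂, by exact_mod_cast e₃⟩

/-! ## §1 The Rosati-invariant elements of `ℤ[α, β]` are `ℤ ⊕ ℤα ⊕ ℤβ` -/

section Symmetric

/-- `(αβ)′ = β′α′ = βα`. [cite: BirkenhakeWilhelm2003, §4 Lemma 4.1 (p. 1827)] [cite: Lange2023AbelianVarietiesComplex, §2.4.1 Lemma 2.4.1] -/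
theorem rosati_humbertRatRep_mul : rosati E₀ (humbertRatRep q * humbertRatRep q') = humbertRatRep q' * humbertRatRep q := by
  rw [rosati_mul isUnit_det_typeForm_one₇, rosati_humbertRatRep, rosati_humbertRatRep]

/-- **The Rosati involution on `ℤ[α, β]` in coordinates: `(c₀ + c₁α + c₂β + c₃αβ)′ = c₀ + c₁α + c₂β + c₃βα`.**
[cite: BirkenhakeWilhelm2003, §4 Lemma 4.1 (p. 1827)] [cite: Runge1999EndomorphismRingsAbelianSurfaces, §6 Thm. 7 (p. 294)] -/
theorem rosati_comb (c₀ c₁ c₂ c₃ : ℤ) :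
    rosati E₀ (c₀ • (1 : 𝕄ℤ) + c₁ • humbertRatRep q + c₂ • humbertRatRep q' + c₃ • (humbertRatRep q * humbertRatRep q')) =
      c₀ • (1 : 𝕄ℤ) + c₁ • humbertRatRep q + c₂ • humbertRatRep q' + c₃ • (humbertRatRep q' * humbertRatRep q) := by
  rw [rosati_add, rosati_add, rosati_add, rosati_smul, rosati_smul, rosati_smul, rosati_smul,
    rosati_one isUnit_det_typeForm_one₇, rosati_humbertRatRep, rosati_humbertRatRep, rosati_humbertRatRep_mul]

/-- The same with `βα` rewritten through Lemma 8: `(…)′ = (c₀ − c₃N(q,q′)) + (c₁ + c₃b′)α + (c₂ + c₃b)β − c₃αβ`.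
[cite: Runge1999EndomorphismRingsAbelianSurfaces, §6 Lemma 8 (p. 295)] -/
theorem rosati_comb_eq (c₀ c₁ c₂ c₃ : ℤ) :
    rosati E₀ (c₀ • (1 : 𝕄ℤ) + c₁ • humbertRatRep q + c₂ • humbertRatRep q' + c₃ • (humbertRatRep q * humbertRatRep q')) =
      (c₀ - c₃ * humbertNormPolar q q') • (1 : 𝕄ℤ) + (c₁ + c₃ * q' 1) • humbertRatRep q + (c₂ + c₃ * q 1) • humbertRatRep q' +
        (-c₃) • (humbertRatRep q * humbertRatRep q') := by
  rw [rosati_comb, humbertRatRep_mul_swap]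
  module

variable {q q'}

/-- **An element of `ℤ[α, β]` is Rosati-invariant iff its `αβ`-coordinate vanishes** (`det S_Δ ≠ 0`): the symmetric
elements of `R = ℤ ⊕ ℤα ⊕ ℤβ ⊕ ℤαβ` form `ℤ ⊕ ℤα ⊕ ℤβ` ("`α` and `β` are … Rosati invariant elements").
[cite: Runge1999EndomorphismRingsAbelianSurfaces, §6 Thm. 7 (p. 294)] [cite: BirkenhakeWilhelm2003, §4 Lemma 4.1 (p. 1827)] -/
theorem rosati_comb_eq_self_iff (hS : humbertInvariant q * humbertInvariant q' ≠ humbertPolar q q' ^ 2) (c₀ c₁ c₂ c₃ : ℤ) :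
    rosati E₀ (c₀ • (1 : 𝕄ℤ) + c₁ • humbertRatRep q + c₂ • humbertRatRep q' + c₃ • (humbertRatRep q * humbertRatRep q')) =
      c₀ • (1 : 𝕄ℤ) + c₁ • humbertRatRep q + c₂ • humbertRatRep q' + c₃ • (humbertRatRep q * humbertRatRep q') ↔ c₃ = 0 := by
  rw [rosati_comb_eq]
  constructor
  · intro h
    obtain ⟨-, -, -, h3⟩ := coords_eq_of_comb_eq_int q q' hS h
    omega
  · rintro rfl
    simp

/-- **Symmetric elements of `ℤ[α, β]`, membership form**: `x ∈ ℤ[α, β]` with `x′ = x` is `c₀ + c₁α + c₂β` with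
`cᵢ ∈ ℤ` (`det S_Δ ≠ 0`). [cite: Runge1999EndomorphismRingsAbelianSurfaces, §6 Thm. 7 (p. 294)] -/
theorem exists_eq_comb_of_rosati_eq_self (hS : humbertInvariant q * humbertInvariant q' ≠ humbertPolar q q' ^ 2)
    {x : 𝕄ℤ} (hx : x ∈ humbertPairOrder q q') (hsym : rosati E₀ x = x) :
    ∃ c₀ c₁ c₂ : ℤ, x = c₀ • (1 : 𝕄ℤ) + c₁ • humbertRatRep q + c₂ • humbertRatRep q' := by
  obtain ⟨c, hc⟩ := exists_eq_comb_of_mem_humbertPairOrder q q' hx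
  have hc' : x = c 0 • (1 : 𝕄ℤ) + c 1 • humbertRatRep q + c 2 • humbertRatRep q' +
      c 3 • (humbertRatRep q * humbertRatRep q') := by
    rw [hc]; simp [Fin.sum_univ_four, humbertPairFamInt]
  rw [hc'] at hsym
  have h3 := (rosati_comb_eq_self_iff hS _ _ _ _).1 hsym
  refine ⟨c 0, c 1, c 2, ?_⟩
  rw [hc', h3, zero_smul, add_zero]

variable (q q')

/-- **`c₀ + xα + yβ = X(c₀, xq + yq′)`**: the symmetric elements of `ℤ[α, β]` are the Rosati matrices of the lattice
`ℤq + ℤq′` of relation vectors. [cite: Runge1999EndomorphismRingsAbelianSurfaces, §4 p. 288 and §6 Thm. 7 (p. 294)] -/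
theorem comb_eq_rosatiMatrix (c₀ x y : ℤ) :
    c₀ • (1 : 𝕄ℤ) + x • humbertRatRep q + y • humbertRatRep q' = rosatiMatrix c₀ (x • q + y • q') := by
  rw [rosatiMatrix_eq_smul_one_add, humbertRatRep_add, humbertRatRep_smul, humbertRatRep_smul, add_assoc]

/-- Conversely every `X(n, xq + yq′)` lies in `ℤ[α, β]` and is symmetric. [cite: Runge1999EndomorphismRingsAbelianSurfaces, §6 Thm. 7 (p. 294)] -/
theorem rosatiMatrix_comb_mem (n x y : ℤ) : rosatiMatrix n (x • q + y • q') ∈ humbertPairOrder q q' := by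
  rw [← comb_eq_rosatiMatrix]
  exact add_mem (add_mem (Subalgebra.smul_mem _ (one_mem _) _)
    (Subalgebra.smul_mem _ (humbertRatRep_mem_humbertPairOrder_left q q') _))
    (Subalgebra.smul_mem _ (humbertRatRep_mem_humbertPairOrder_right q q') _)

/-! ### The anti-symmetric line `ℚγ`, `γ = αβ − βα` ("up to multiplication by a non-zero rational number … a unique
element with `γ′ = −γ`"), `t(γ) = 0`, `n(γ) = d`, `γ² = −n(γ)` -/

/-- **`x − x′ = c₃γ`** for `x = c₀ + c₁α + c₂β + c₃αβ`. [cite: Runge1999EndomorphismRingsAbelianSurfaces, §6 proof of Thm. 7 (p. 295)] -/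
theorem comb_sub_rosati_comb (c₀ c₁ c₂ c₃ : ℤ) :
    c₀ • (1 : 𝕄ℤ) + c₁ • humbertRatRep q + c₂ • humbertRatRep q' + c₃ • (humbertRatRep q * humbertRatRep q') -
      rosati E₀ (c₀ • (1 : 𝕄ℤ) + c₁ • humbertRatRep q + c₂ • humbertRatRep q' + c₃ • (humbertRatRep q * humbertRatRep q')) =
      c₃ • humbertComm q q' := by
  rw [rosati_comb, humbertComm_def, smul_sub]
  abel

/-- **Anti-symmetric elements: `x′ = −x ⟺ 2x = c₃γ`** (every pair; no hypothesis on `S_Δ`).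
[cite: Runge1999EndomorphismRingsAbelianSurfaces, §6 proof of Thm. 7 (p. 295)] -/
theorem rosati_comb_eq_neg_iff (c₀ c₁ c₂ c₃ : ℤ) :
    rosati E₀ (c₀ • (1 : 𝕄ℤ) + c₁ • humbertRatRep q + c₂ • humbertRatRep q' + c₃ • (humbertRatRep q * humbertRatRep q')) =
      -(c₀ • (1 : 𝕄ℤ) + c₁ • humbertRatRep q + c₂ • humbertRatRep q' + c₃ • (humbertRatRep q * humbertRatRep q')) ↔
      (2 : ℤ) • (c₀ • (1 : 𝕄ℤ) + c₁ • humbertRatRep q + c₂ • humbertRatRep q' + c₃ • (humbertRatRep q * humbertRatRep q')) =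
        c₃ • humbertComm q q' := by
  have h := comb_sub_rosati_comb q q' c₀ c₁ c₂ c₃
  constructor
  · intro hneg
    rw [hneg, sub_neg_eq_add, ← two_smul ℤ] at h
    exact h
  · intro h2
    rw [two_smul] at h2
    rw [← h2] at h
    -- `x − x′ = x + x`
    have := sub_eq_iff_eq_add.1 h
    -- `x = x + x + x′` ⟹ `x′ = −x`
    linear_combination (norm := skip) -this
    abel

variable {q q'}

/-- **"Up to multiplication by a non-zero rational number, `γ = αβ − βα` is the unique element with `γ′ = −γ`"**: an
anti-symmetric `x ∈ ℤ[α, β]` satisfies `2x ∈ ℤγ`. [cite: Runge1999EndomorphismRingsAbelianSurfaces, §6 proof of Thm. 7 (p. 295)] -/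
theorem exists_two_smul_eq_smul_humbertComm {x : 𝕄ℤ} (hx : x ∈ humbertPairOrder q q') (hanti : rosati E₀ x = -x) :
    ∃ m : ℤ, (2 : ℤ) • x = m • humbertComm q q' := by
  obtain ⟨c, hc⟩ := exists_eq_comb_of_mem_humbertPairOrder q q' hx
  have hc' : x = c 0 • (1 : 𝕄ℤ) + c 1 • humbertRatRep q + c 2 • humbertRatRep q' +
      c 3 • (humbertRatRep q * humbertRatRep q') := by
    rw [hc]; simp [Fin.sum_univ_four, humbertPairFamInt]
  refine ⟨c 3, ?_⟩
  rw [hc'] at hanti ⊢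
  exact (rosati_comb_eq_neg_iff q q' _ _ _ _).1 hanti

variable (q q')

/-- **`t(γ) = 0`.** [cite: Runge1999EndomorphismRingsAbelianSurfaces, §6 proof of Thm. 7 (p. 295: "`γ² = −n(γ)`")] -/
theorem rungeTrace_humbertComm : rungeTrace ((humbertComm q q').map (Int.cast : ℤ → ℚ)) = 0 := by
  rw [humbertComm_def, castQ_sub, castQ_mul, castQ_mul, map_sub, rungeTrace_mul_comm, sub_self]

/-- **`n(γ) = d(ℤ[α, β]) = det(S_Δ)/4`** (`= −γ²`). [cite: Runge1999EndomorphismRingsAbelianSurfaces, §6 proof of Thm. 7 (p. 295: "`γ² = −n(γ) = (Δ(α, β)² − Δ(α)Δ(β))/4`")] -/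
theorem rungeNorm_humbertComm : rungeNorm ((humbertComm q q').map (Int.cast : ℤ → ℚ)) = pairDiscr q q' := by
  rw [rungeNorm_def, rungeTrace_humbertComm, ← castQ_mul, humbertComm_mul_self, castQ_smul, castQ_one, map_smul,
    rungeTrace_one, pairDiscr]
  simp only [smul_eq_mul, Int.cast_neg]
  ring

/-- **`γ² = −n(γ)·1`.** [cite: Runge1999EndomorphismRingsAbelianSurfaces, §6 proof of Thm. 7 (p. 295)] -/
theorem humbertComm_mul_self_eq_neg_rungeNorm :
    (humbertComm q q' * humbertComm q q').map (Int.cast : ℤ → ℚ) =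
      -(rungeNorm ((humbertComm q q').map (Int.cast : ℤ → ℚ))) • (1 : 𝕄) := by
  rw [rungeNorm_humbertComm, humbertComm_mul_self, castQ_smul, castQ_one, pairDiscr, Int.cast_neg, neg_neg]

end Symmetric

/-! ## §2 `Δ(c₀ + xα + yβ) = S_Δ[x, y]` -/

section DiscForm

/-- **The binary form `S_Δ[x, y] = x²Δ(α) + 2xyΔ(α, β) + y²Δ(β)`** of Runge's discriminant matrix (`discMatrix q q′`,
row A4-66 FILE 3), i.e. Humbert's `Δ(xq + yq′)`. [cite: Runge1999EndomorphismRingsAbelianSurfaces, §6 Thm. 7 (p. 295) and Cor. 9 (i) (p. 295: "`Δ` is primitively represented by the quadratic form `S_Δ`")] -/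
def discForm₂ (q q' : Fin 5 → ℤ) (x y : ℤ) : ℤ :=
  x ^ 2 * humbertInvariant q + 2 * x * y * humbertPolar q q' + y ^ 2 * humbertInvariant q'

/-- `S_Δ[x, y] = Δ(xq + yq′)` (Humbert's invariant of the combined relation). [cite: Runge1999EndomorphismRingsAbelianSurfaces, §6 p. 294 ("`Δ(x,y) = ½(Δ(x+y) − Δ(x) − Δ(y))`")] -/
theorem discForm₂_eq_humbertInvariant (x y : ℤ) : discForm₂ q q' x y = humbertInvariant (x • q + y • q') := by
  rw [discForm₂, humbertInvariant_add_smul_smul]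

/-- `S_Δ[x, y] = (x, y) S_Δ ᵗ(x, y)` through the matrix `discMatrix`. [cite: Runge1999EndomorphismRingsAbelianSurfaces, §6 Thm. 7 (p. 295)] -/
theorem discForm₂_eq_dotProduct (x y : ℤ) : discForm₂ q q' x y = ![x, y] ⬝ᵥ (discMatrix q q' *ᵥ ![x, y]) := by
  simp [discForm₂, discMatrix, Matrix.mulVec, dotProduct, Fin.sum_univ_two]
  ring

/-- **`Δ(c₀ + xα + yβ) = S_Δ[x, y]`**: on the symmetric elements of `ℤ[α, β]` Runge's (ternary) discriminant form is
the binary form `S_Δ` — independent of the scalar part `c₀` ("identically zero on `ℚ`").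
[cite: Runge1999EndomorphismRingsAbelianSurfaces, §6 p. 294 and Cor. 9 (p. 295)] -/
theorem rungeDisc_comb_eq_discForm₂ (c₀ x y : ℤ) :
    rungeDisc ((c₀ • (1 : 𝕄ℤ) + x • humbertRatRep q + y • humbertRatRep q').map (Int.cast : ℤ → ℚ)) =
      discForm₂ q q' x y := by
  rw [comb_eq_rosatiMatrix, rungeDisc_map_rosatiMatrix, discForm₂_eq_humbertInvariant]

end DiscForm

/-! ## §3 `R ∩ ℚ(ω)` for a symmetric `ω = n + g(x′α + y′β)` with `g.c.d.(x′, y′) = 1` -/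

section Optimal

variable {q q'}

/-- **`R ∩ ℚ(ω)` in coordinates**: for `ω = n + g(x′α + y′β)` (`g ≠ 0`, `g.c.d.(x′, y′) = 1`) an element of
`R = ℤ[α, β]` lies in `ℚ(ω) = ℚ1 + ℚω` iff it is `m + j(x′α + y′β)` with `m, j ∈ ℤ` — so `R ∩ ℚ(ω) = ℤ[x′α + y′β]`,
which contains `ℤ[ω] = ℤ + ℤ·g(x′α + y′β)` with index `|g|`. [cite: Runge1999EndomorphismRingsAbelianSurfaces, §6 Cor. 9 (ii) (p. 296: "`R ∩ ℚ(ω) = O`")] -/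
theorem map_mem_span_pair_iff (hS : humbertInvariant q * humbertInvariant q' ≠ humbertPolar q q' ^ 2)
    {n g x' y' : ℤ} (hg : g ≠ 0) (hcop : IsCoprime x' y') {z : 𝕄ℤ} (hz : z ∈ humbertPairOrder q q') :
    z.map (Int.cast : ℤ → ℚ) ∈ Submodule.span ℚ
        ({1, (n • (1 : 𝕄ℤ) + (g * x') • humbertRatRep q + (g * y') • humbertRatRep q').map (Int.cast : ℤ → ℚ)} : Set 𝕄) ↔
      ∃ m j : ℤ, z = m • (1 : 𝕄ℤ) + j • (x' • humbertRatRep q + y' • humbertRatRep q') := by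
  obtain ⟨c, hc⟩ := exists_eq_comb_of_mem_humbertPairOrder q q' hz
  have hc' : z = c 0 • (1 : 𝕄ℤ) + c 1 • humbertRatRep q + c 2 • humbertRatRep q' +
      c 3 • (humbertRatRep q * humbertRatRep q') := by
    rw [hc]; simp [Fin.sum_univ_four, humbertPairFamInt]
  have hω : (n • (1 : 𝕄ℤ) + (g * x') • humbertRatRep q + (g * y') • humbertRatRep q').map (Int.cast : ℤ → ℚ) =
      (n : ℚ) • (1 : 𝕄) + ((g * x' : ℤ) : ℚ) • αℚ + ((g * y' : ℤ) : ℚ) • βℚ := by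
    simp only [castQ_add, castQ_smul, castQ_one]
  constructor
  · intro hmem
    rw [Submodule.mem_span_pair] at hmem
    obtain ⟨a, b, hab⟩ := hmem
    rw [hω, hc'] at hab
    simp only [castQ_add, castQ_smul, castQ_mul, castQ_one] at hab
    -- compare coordinates
    have hab' : (a + b * n) • (1 : 𝕄) + (b * (g * x')) • αℚ + (b * (g * y')) • βℚ + (0 : ℚ) • (αℚ * βℚ) =
        (c 0 : ℚ) • (1 : 𝕄) + (c 1 : ℚ) • αℚ + (c 2 : ℚ) • βℚ + (c 3 : ℚ) • (αℚ * βℚ) := by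
      rw [← hab]; push_cast; module
    obtain ⟨e₀, e₁, e₂, e₃⟩ := coords_eq_of_comb_eq_rat q q' hS hab'
    -- `b g ∈ ℤ` by Bezout
    obtain ⟨u, v, huv⟩ := hcop
    have hbg : b * g = ((u * c 1 + v * c 2 : ℤ) : ℚ) := by
      push_cast
      rw [← e₁, ← e₂]
      have : (u : ℚ) * x' + v * y' = 1 := by exact_mod_cast huv
      linear_combination (-(b * g)) * this
    refine ⟨c 0, u * c 1 + v * c 2, ?_⟩
    have h1 : c 1 = (u * c 1 + v * c 2) * x' := by
      have : (c 1 : ℚ) = ((u * c 1 + v * c 2 : ℤ) : ℚ) * x' := by rw [← hbg, ← e₁]; ring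
      exact_mod_cast this
    have h2 : c 2 = (u * c 1 + v * c 2) * y' := by
      have : (c 2 : ℚ) = ((u * c 1 + v * c 2 : ℤ) : ℚ) * y' := by rw [← hbg, ← e₂]; ring
      exact_mod_cast this
    have h3 : c 3 = 0 := by exact_mod_cast e₃.symm
    rw [hc', h3, zero_smul, add_zero, smul_add, smul_smul, smul_smul, ← h1, ← h2, add_assoc]
  · rintro ⟨m, j, rfl⟩
    rw [Submodule.mem_span_pair]
    refine ⟨(m : ℚ) - (j : ℚ) / g * n, (j : ℚ) / g, ?_⟩
    have hgQ : (g : ℚ) ≠ 0 := by exact_mod_cast hg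
    have e1 : (j : ℚ) / g * g = j := div_mul_cancel₀ _ hgQ
    rw [hω]
    simp only [castQ_add, castQ_smul, castQ_one]
    push_cast
    have hsc : ((j : ℚ) / g) • ((n : ℚ) • (1 : 𝕄) + ((g : ℚ) * x') • αℚ + ((g : ℚ) * y') • βℚ) =
        ((j : ℚ) / g * n) • (1 : 𝕄) + ((j : ℚ) * x') • αℚ + ((j : ℚ) * y') • βℚ := by
      rw [smul_add, smul_add, smul_smul, smul_smul, smul_smul, ← mul_assoc ((j : ℚ) / g) (g : ℚ) (x' : ℚ),
        ← mul_assoc ((j : ℚ) / g) (g : ℚ) (y' : ℚ), e1]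
    rw [hsc]
    module

/-- **Optimality: `R ∩ ℚ(ω) = ℤ[ω]` iff `g = ±1`** for `ω = n + g(x′α + y′β)`, `g.c.d.(x′, y′) = 1`, `g ≠ 0` — i.e. iff
the coefficient vector `(gx′, gy′)` of `ω` is primitive. [cite: Runge1999EndomorphismRingsAbelianSurfaces, §6 Cor. 9 (i) ⟺ (ii) (pp. 295–296)] -/
theorem optimal_iff_isUnit (hS : humbertInvariant q * humbertInvariant q' ≠ humbertPolar q q' ^ 2)
    {n g x' y' : ℤ} (hg : g ≠ 0) (hcop : IsCoprime x' y') :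
    (∀ z ∈ humbertPairOrder q q',
        z.map (Int.cast : ℤ → ℚ) ∈ Submodule.span ℚ
          ({1, (n • (1 : 𝕄ℤ) + (g * x') • humbertRatRep q + (g * y') • humbertRatRep q').map (Int.cast : ℤ → ℚ)} : Set 𝕄) →
        ∃ m j : ℤ, z = m • (1 : 𝕄ℤ) + j • (n • (1 : 𝕄ℤ) + (g * x') • humbertRatRep q + (g * y') • humbertRatRep q')) ↔
      IsUnit g := by
  constructor
  · intro h
    -- test on `z = x′α + y′β ∈ R ∩ ℚ(ω)`
    have hz : x' • humbertRatRep q + y' • humbertRatRep q' ∈ humbertPairOrder q q' :=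
      add_mem (Subalgebra.smul_mem _ (humbertRatRep_mem_humbertPairOrder_left q q') _)
        (Subalgebra.smul_mem _ (humbertRatRep_mem_humbertPairOrder_right q q') _)
    have hmem := (map_mem_span_pair_iff hS (n := n) hg hcop hz).2 ⟨0, 1, by rw [zero_smul, one_smul, zero_add]⟩
    obtain ⟨m, j, hmj⟩ := h _ hz hmem
    have hmj' : (0 : ℤ) • (1 : 𝕄ℤ) + x' • humbertRatRep q + y' • humbertRatRep q' + (0 : ℤ) • (humbertRatRep q * humbertRatRep q') =
        (m + j * n) • (1 : 𝕄ℤ) + (j * (g * x')) • humbertRatRep q + (j * (g * y')) • humbertRatRep q' +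
          (0 : ℤ) • (humbertRatRep q * humbertRatRep q') := by
      rw [zero_smul, zero_add, zero_smul, add_zero, hmj]; module
    obtain ⟨-, e₁, e₂, -⟩ := coords_eq_of_comb_eq_int q q' hS hmj'
    -- `x′ = j g x′`, `y′ = j g y′`, `(x′, y′) ≠ 0` ⟹ `j g = 1`
    obtain ⟨u, v, huv⟩ := hcop
    have : (j * g) * (u * x' + v * y') = u * x' + v * y' := by
      have e₁' : x' = j * g * x' := by rw [mul_assoc]; exact e₁
      have e₂' : y' = j * g * y' := by rw [mul_assoc]; exact e₂
      linear_combination u * e₁'.symm + v * e₂'.symm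
    rw [huv, mul_one] at this
    exact IsUnit.of_mul_eq_one_right j this
  · intro hunit z hz hmem
    obtain ⟨m, j, rfl⟩ := (map_mem_span_pair_iff hS (n := n) hg hcop hz).1 hmem
    obtain ⟨w, hw⟩ := hunit.exists_left_inv
    refine ⟨m - w * j * n, w * j, ?_⟩
    have ex : w * j * (g * x') = j * x' := by
      calc w * j * (g * x') = (w * g) * (j * x') := by ring
        _ = j * x' := by rw [hw, one_mul]
    have ey : w * j * (g * y') = j * y' := by
      calc w * j * (g * y') = (w * g) * (j * y') := by ring
        _ = j * y' := by rw [hw, one_mul]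
    rw [show (w * j) • (n • (1 : 𝕄ℤ) + (g * x') • humbertRatRep q + (g * y') • humbertRatRep q') =
        (w * j * n) • (1 : 𝕄ℤ) + (w * j * (g * x')) • humbertRatRep q + (w * j * (g * y')) • humbertRatRep q' by
      simp only [smul_add, smul_smul], ex, ey]
    module

end Optimal

/-! ## §4 Runge's Corollary 9, (i) ⟺ (ii), for the order `R = ℤ[α, β]` -/

section CorollaryNine

variable {q q'}

/-- **COROLLARY 9 (i) ⟹ (ii)**: if `Δ = S_Δ[x, y]` with `g.c.d.(x, y) = 1`, then `ω := xα + yβ ∈ R` is a SYMMETRIC element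
of discriminant `Δ` with `R ∩ ℚ(ω) = ℤ[ω]` (an optimal embedding of `ℤ[ω]`).
[cite: Runge1999EndomorphismRingsAbelianSurfaces, §6 Cor. 9 (pp. 295–296)] -/
theorem exists_optimal_of_primitively_represented (hS : humbertInvariant q * humbertInvariant q' ≠ humbertPolar q q' ^ 2)
    {Δ x y : ℤ} (hcop : IsCoprime x y) (hΔ : discForm₂ q q' x y = Δ) :
    ∃ ω ∈ humbertPairOrder q q', rosati E₀ ω = ω ∧ rungeDisc (ω.map (Int.cast : ℤ → ℚ)) = Δ ∧
      (∀ c : ℤ, ω ≠ c • (1 : 𝕄ℤ)) ∧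
      ∀ z ∈ humbertPairOrder q q', z.map (Int.cast : ℤ → ℚ) ∈ Submodule.span ℚ ({1, ω.map (Int.cast : ℤ → ℚ)} : Set 𝕄) →
        ∃ m j : ℤ, z = m • (1 : 𝕄ℤ) + j • ω := by
  refine ⟨(0 : ℤ) • (1 : 𝕄ℤ) + (1 * x) • humbertRatRep q + (1 * y) • humbertRatRep q', ?_, ?_, ?_, ?_, ?_⟩
  · rw [one_mul, one_mul, comb_eq_rosatiMatrix]; exact rosatiMatrix_comb_mem q q' 0 x y
  · have h := (rosati_comb_eq_self_iff hS 0 (1 * x) (1 * y) 0).2 rfl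
    simpa only [zero_smul, add_zero] using h
  · rw [one_mul, one_mul, rungeDisc_comb_eq_discForm₂, hΔ]
  · intro c hc
    rw [one_mul, one_mul] at hc
    have hc' : (0 : ℤ) • (1 : 𝕄ℤ) + x • humbertRatRep q + y • humbertRatRep q' + (0 : ℤ) • (humbertRatRep q * humbertRatRep q') =
        c • (1 : 𝕄ℤ) + (0 : ℤ) • humbertRatRep q + (0 : ℤ) • humbertRatRep q' + (0 : ℤ) • (humbertRatRep q * humbertRatRep q') := by
      rw [hc]; module
    obtain ⟨-, hx, hy, -⟩ := coords_eq_of_comb_eq_int q q' hS hc'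
    rw [hx, hy] at hcop
    exact not_isCoprime_zero_zero hcop
  · exact (optimal_iff_isUnit hS (n := 0) one_ne_zero hcop).2 isUnit_one

/-- **COROLLARY 9 (ii) ⟹ (i)**: a symmetric, non-scalar `ω ∈ R` with `Δ(ω) = Δ` and `R ∩ ℚ(ω) = ℤ[ω]` yields a PRIMITIVE
representation `Δ = S_Δ[x, y]` (`ω = n + xα + yβ` with `g.c.d.(x, y) = 1`).
[cite: Runge1999EndomorphismRingsAbelianSurfaces, §6 Cor. 9 (pp. 295–296)] -/
theorem primitively_represented_of_optimal (hS : humbertInvariant q * humbertInvariant q' ≠ humbertPolar q q' ^ 2)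
    {Δ : ℤ} {ω : 𝕄ℤ} (hω : ω ∈ humbertPairOrder q q') (hsym : rosati E₀ ω = ω)
    (hΔ : rungeDisc (ω.map (Int.cast : ℤ → ℚ)) = Δ) (hns : ∀ c : ℤ, ω ≠ c • (1 : 𝕄ℤ))
    (hopt : ∀ z ∈ humbertPairOrder q q', z.map (Int.cast : ℤ → ℚ) ∈ Submodule.span ℚ ({1, ω.map (Int.cast : ℤ → ℚ)} : Set 𝕄) →
      ∃ m j : ℤ, z = m • (1 : 𝕄ℤ) + j • ω) :
    ∃ x y : ℤ, IsCoprime x y ∧ discForm₂ q q' x y = Δ := by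
  obtain ⟨c₀, x, y, rfl⟩ := exists_eq_comb_of_rosati_eq_self hS hω hsym
  -- `(x, y) ≠ 0`
  have hxy : Int.gcd x y ≠ 0 := by
    intro h0
    rw [Int.gcd_eq_zero_iff] at h0
    exact hns c₀ (by rw [h0.1, h0.2, zero_smul, zero_smul, add_zero, add_zero])
  obtain ⟨g, x', y', hgpos, hcop', hx, hy⟩ := Int.exists_gcd_one' (Nat.pos_of_ne_zero hxy)
  have hcop : IsCoprime x' y' := Int.isCoprime_iff_gcd_eq_one.2 hcop'
  have hg : (g : ℤ) ≠ 0 := by exact_mod_cast hgpos.ne'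
  -- `ω = c₀ + g(x′α + y′β)`; optimality forces `g = 1`
  have hωeq : c₀ • (1 : 𝕄ℤ) + x • humbertRatRep q + y • humbertRatRep q' =
      c₀ • (1 : 𝕄ℤ) + ((g : ℤ) * x') • humbertRatRep q + ((g : ℤ) * y') • humbertRatRep q' := by
    rw [hx, hy, mul_comm x', mul_comm y']
  rw [hωeq] at hopt
  have hunit := (optimal_iff_isUnit hS (n := c₀) hg hcop).1 hopt
  have hg1 : (g : ℤ) = 1 := by
    rcases Int.isUnit_iff.1 hunit with h | h
    · exact h
    · exfalso; omega
  refine ⟨x, y, ?_, ?_⟩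
  · rw [hx, hy, hg1, mul_one, mul_one]; exact hcop
  · have h := rungeDisc_comb_eq_discForm₂ q q' c₀ x y
    rw [hΔ] at h
    exact_mod_cast h.symm

/-- **RUNGE'S COROLLARY 9, (i) ⟺ (ii), for the order `R = ℤ[α, β] = ℤ ⊕ ℤα ⊕ ℤβ ⊕ ℤαβ`** (`det S_Δ ≠ 0`): "`Δ` is
primitively represented by the quadratic form `S_Δ`" iff "there exists an embedding `O = ℤ[ω] ↪ R` such that
`R ∩ ℚ(ω) = O`" — with `ω` Rosati-invariant and non-scalar, `Δ(ω) = Δ`, `ℚ(ω) = ℚ1 + ℚω`.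
[cite: Runge1999EndomorphismRingsAbelianSurfaces, §6 Cor. 9 (pp. 295–296)] -/
theorem runge_cor_nine_i_iff_ii (hS : humbertInvariant q * humbertInvariant q' ≠ humbertPolar q q' ^ 2) (Δ : ℤ) :
    (∃ x y : ℤ, IsCoprime x y ∧ discForm₂ q q' x y = Δ) ↔
      ∃ ω ∈ humbertPairOrder q q', rosati E₀ ω = ω ∧ rungeDisc (ω.map (Int.cast : ℤ → ℚ)) = Δ ∧
        (∀ c : ℤ, ω ≠ c • (1 : 𝕄ℤ)) ∧
        ∀ z ∈ humbertPairOrder q q', z.map (Int.cast : ℤ → ℚ) ∈ Submodule.span ℚ ({1, ω.map (Int.cast : ℤ → ℚ)} : Set 𝕄) →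
          ∃ m j : ℤ, z = m • (1 : 𝕄ℤ) + j • ω := by
  constructor
  · rintro ⟨x, y, hcop, hΔ⟩
    exact exists_optimal_of_primitively_represented hS hcop hΔ
  · rintro ⟨ω, hω, hsym, hΔ, hns, hopt⟩
    exact primitively_represented_of_optimal hS hω hsym hΔ hns hopt

end CorollaryNine

/-! ## §5 `Sp₄(ℤ)`-invariance: `S_Δ`, `d(ℤ[α, β])` and the order itself under `(q, q′) ↦ (q^M, q′^M)` -/

section Transport

variable {q q'}
variable {M : 𝕄ℤ}

/-- `Sp₄(ℤ)` in the tree's form `ᵗM E₀ M = E₀` (rows A4-59″/A4-65). -/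
local notation "IsSp" M:max => Mᵀ * typeForm (fun _ : Fin 2 ↦ 1) * M = typeForm fun _ : Fin 2 ↦ 1

/-- **The discriminant form is `Sp₄(ℤ)`-invariant: `Δ(q^M, q′^M) = Δ(q, q′)`** (polarisation of row A4-59″'s
`Δ(q^M) = Δ(q)`). [cite: Runge1999EndomorphismRingsAbelianSurfaces, §6 p. 296 ("to characterize bases up to conjugation by a symplectic matrix … with the same discriminant matrix")] [cite: BirkenhakeWilhelm2003, §1 (∗) (p. 1819)] -/
theorem humbertPolar_humbertVectorConj (hM : IsSp M) (q q' : Fin 5 → ℤ) :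
    humbertPolar (humbertVectorConj M q) (humbertVectorConj M q') = humbertPolar q q' := by
  have h := humbertInvariant_humbertVectorConj hM (q + q')
  rw [humbertVectorConj_add, humbertInvariant_add, humbertInvariant_add, humbertInvariant_humbertVectorConj hM,
    humbertInvariant_humbertVectorConj hM] at h
  linarith

/-- **Runge's discriminant matrix `S_Δ` is an invariant of the `Sp₄(ℤ)`-orbit of the pair.**
[cite: Runge1999EndomorphismRingsAbelianSurfaces, §6 p. 296] -/
theorem discMatrix_humbertVectorConj (hM : IsSp M) (q q' : Fin 5 → ℤ) :
    discMatrix (humbertVectorConj M q) (humbertVectorConj M q') = discMatrix q q' := by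
  simp only [discMatrix, humbertInvariant_humbertVectorConj hM, humbertPolar_humbertVectorConj hM]

/-- `S_Δ[x, y]` is `Sp₄(ℤ)`-invariant. [cite: Runge1999EndomorphismRingsAbelianSurfaces, §6 p. 296] -/
theorem discForm₂_humbertVectorConj (hM : IsSp M) (q q' : Fin 5 → ℤ) (x y : ℤ) :
    discForm₂ (humbertVectorConj M q) (humbertVectorConj M q') x y = discForm₂ q q' x y := by
  simp only [discForm₂, humbertInvariant_humbertVectorConj hM, humbertPolar_humbertVectorConj hM]

/-- `γ²` is `Sp₄(ℤ)`-invariant. [cite: Runge1999EndomorphismRingsAbelianSurfaces, §6 p. 296] -/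
theorem gammaSq_humbertVectorConj (hM : IsSp M) (q q' : Fin 5 → ℤ) :
    gammaSq (humbertVectorConj M q) (humbertVectorConj M q') = gammaSq q q' := by
  have h1 := four_mul_gammaSq (humbertVectorConj M q) (humbertVectorConj M q')
  rw [humbertInvariant_humbertVectorConj hM, humbertInvariant_humbertVectorConj hM,
    humbertPolar_humbertVectorConj hM, ← four_mul_gammaSq] at h1
  linarith

/-- **`d(ℤ[α, β]) = det(S_Δ)/4` is an invariant of the `Sp₄(ℤ)`-orbit of the pair `(q, q′)`.**
[cite: Runge1999EndomorphismRingsAbelianSurfaces, §6 Thm. 7 (p. 295) and p. 296] -/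
theorem pairDiscr_humbertVectorConj (hM : IsSp M) (q q' : Fin 5 → ℤ) :
    pairDiscr (humbertVectorConj M q) (humbertVectorConj M q') = pairDiscr q q' := by
  rw [pairDiscr, pairDiscr, gammaSq_humbertVectorConj hM]

/-- Conjugation `x ↦ M⁻¹ x M` is additive. [folklore] -/
private theorem conj_sum (M : 𝕄ℤ) (c : Fin 4 → ℤ) (v : Fin 4 → 𝕄ℤ) :
    spInv M * (∑ i, c i • v i) * M = ∑ i, c i • (spInv M * v i * M) := by
  rw [Finset.mul_sum, Finset.sum_mul]
  refine Finset.sum_congr rfl fun i _ ↦ ?_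
  rw [Matrix.mul_smul, Matrix.smul_mul]

/-- **Transport of the order: `M⁻¹ ℤ[α, β] M ⊆ ℤ[α^M, β^M]`** for `M ∈ Sp₄(ℤ)` — conjugation by a symplectic matrix maps
the order of the pair `(q, q′)` into the order of the transformed pair `(q^M, q′^M)` (B–W (7):
`M⁻¹R₀(q)M = R₀(q^M) + t·1`, row A4-65 FILE 3). [cite: Runge1999EndomorphismRingsAbelianSurfaces, §6 proof of Thm. 7 (p. 295: "By Theorem 2 we may assume") and p. 296] [cite: BirkenhakeWilhelm2003, §4 eq. (7) (p. 1827)] -/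
theorem conj_mem_humbertPairOrder (hM : IsSp M) {x : 𝕄ℤ} (hx : x ∈ humbertPairOrder q q') :
    spInv M * x * M ∈ humbertPairOrder (humbertVectorConj M q) (humbertVectorConj M q') := by
  obtain ⟨c, rfl⟩ := exists_eq_comb_of_mem_humbertPairOrder q q' hx
  rw [conj_sum]
  refine Subalgebra.sum_mem _ fun i _ ↦ Subalgebra.smul_mem _ ?_ _
  have hα : spInv M * humbertRatRep q * M ∈ humbertPairOrder (humbertVectorConj M q) (humbertVectorConj M q') := by
    rw [spInv_mul_humbertRatRep_mul]
    exact add_mem (humbertRatRep_mem_humbertPairOrder_left _ _) (Subalgebra.smul_mem _ (one_mem _) _)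
  have hβ : spInv M * humbertRatRep q' * M ∈ humbertPairOrder (humbertVectorConj M q) (humbertVectorConj M q') := by
    rw [spInv_mul_humbertRatRep_mul]
    exact add_mem (humbertRatRep_mem_humbertPairOrder_right _ _) (Subalgebra.smul_mem _ (one_mem _) _)
  fin_cases i
  · show spInv M * 1 * M ∈ _
    rw [Matrix.mul_one, spInv_mul hM]; exact one_mem _
  · exact hα
  · exact hβ
  · show spInv M * (humbertRatRep q * humbertRatRep q') * M ∈ _
    have : spInv M * (humbertRatRep q * humbertRatRep q') * M =
        (spInv M * humbertRatRep q * M) * (spInv M * humbertRatRep q' * M) := by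
      rw [show (spInv M * humbertRatRep q * M) * (spInv M * humbertRatRep q' * M) =
          spInv M * humbertRatRep q * (M * spInv M) * humbertRatRep q' * M by simp only [Matrix.mul_assoc],
        mul_spInv hM, Matrix.mul_one]
      simp only [Matrix.mul_assoc]
    rw [this]
    exact mul_mem hα hβ

end Transport

/-! ## §6 The saturation criterion for a general pair: "By Theorem 2 we may assume" `α` in normal form -/

section GeneralPair

variable {q q'}
variable {M : 𝕄ℤ}

/-- `Sp₄(ℤ)` in the tree's form `ᵗM E₀ M = E₀`. -/
local notation "IsSp" M:max => Mᵀ * typeForm (fun _ : Fin 2 ↦ 1) * M = typeForm fun _ : Fin 2 ↦ 1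

/-- `(M⁻¹)⁻¹ = M` for the symplectic adjoint `M⁻¹ = −E₀ ᵗM E₀` (`ᵗE₀ = −E₀`, `E₀² = −1`). [cite: Lange2023AbelianVarietiesComplex, §8.2 (8.5)] -/
theorem spInv_spInv (M : 𝕄ℤ) : spInv (spInv M) = M := by
  rw [spInv, spInv, transpose_neg, transpose_mul, transpose_mul, transpose_transpose, transpose_typeForm]
  simp only [Matrix.neg_mul, Matrix.mul_neg, neg_neg, Matrix.mul_assoc]
  rw [typeForm_one_mul_self, ← Matrix.mul_assoc, ← Matrix.mul_assoc, typeForm_one_mul_self]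
  simp

/-- `M (M⁻¹ x M) M⁻¹ = x`. [cite: Lange2023AbelianVarietiesComplex, §8.2 (8.5)] -/
theorem mul_conj_mul_spInv (hM : IsSp M) (x : 𝕄ℤ) : M * (spInv M * x * M) * spInv M = x := by
  rw [show M * (spInv M * x * M) * spInv M = (M * spInv M) * x * (M * spInv M) by simp only [Matrix.mul_assoc],
    mul_spInv hM, Matrix.one_mul, Matrix.mul_one]

/-- **`M⁻¹ ℤ[α, β] M = ℤ[α^M, β^M]`, membership form** (both inclusions). [cite: Runge1999EndomorphismRingsAbelianSurfaces, §6 proof of Thm. 7 (p. 295) and p. 296] [cite: BirkenhakeWilhelm2003, §4 eq. (7) (p. 1827)] -/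
theorem conj_mem_humbertPairOrder_iff (hM : IsSp M) (x : 𝕄ℤ) :
    spInv M * x * M ∈ humbertPairOrder (humbertVectorConj M q) (humbertVectorConj M q') ↔ x ∈ humbertPairOrder q q' := by
  refine ⟨fun h ↦ ?_, conj_mem_humbertPairOrder hM⟩
  have h' := conj_mem_humbertPairOrder (spInv_symplectic hM) h
  rwa [humbertVectorConj_spInv_humbertVectorConj hM, humbertVectorConj_spInv_humbertVectorConj hM, spInv_spInv,
    mul_conj_mul_spInv hM] at h'

/-- **`M⁻¹ (ℚ(α, β) ∩ M₄(ℤ)) M ⊆ ℚ(α^M, β^M) ∩ M₄(ℤ)`** for `M ∈ Sp₄(ℤ)`. [cite: Runge1999EndomorphismRingsAbelianSurfaces, §6 proof of Thm. 7 (p. 295: "By Theorem 2 we may assume")] -/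
theorem conj_mem_humbertPairAlgInt (hM : IsSp M) {x : 𝕄ℤ} (hx : x ∈ humbertPairAlgInt q q') :
    spInv M * x * M ∈ humbertPairAlgInt (humbertVectorConj M q) (humbertVectorConj M q') := by
  rw [mem_humbertPairAlgInt_iff] at hx ⊢
  obtain ⟨c₀, c₁, c₂, c₃, hx'⟩ := exists_eq_comb_of_mem_humbertPairAlg q q' hx
  have key : ∀ y : 𝕄ℤ, y ∈ humbertPairOrder q q' →
      (spInv M).map (Int.cast : ℤ → ℚ) * y.map (Int.cast : ℤ → ℚ) * M.map (Int.cast : ℤ → ℚ) ∈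
        humbertPairAlg (humbertVectorConj M q) (humbertVectorConj M q') := by
    intro y hy
    rw [← castQ_mul, ← castQ_mul]
    exact map_mem_humbertPairAlg_of_mem _ _ (conj_mem_humbertPairOrder hM hy)
  rw [castQ_mul, castQ_mul, hx']
  have e : (spInv M).map (Int.cast : ℤ → ℚ) * (c₀ • (1 : 𝕄) + c₁ • αℚ + c₂ • βℚ + c₃ • (αℚ * βℚ)) * M.map (Int.cast : ℤ → ℚ) =
      c₀ • ((spInv M).map (Int.cast : ℤ → ℚ) * (1 : 𝕄ℤ).map (Int.cast : ℤ → ℚ) * M.map (Int.cast : ℤ → ℚ)) +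
      c₁ • ((spInv M).map (Int.cast : ℤ → ℚ) * αℚ * M.map (Int.cast : ℤ → ℚ)) +
      c₂ • ((spInv M).map (Int.cast : ℤ → ℚ) * βℚ * M.map (Int.cast : ℤ → ℚ)) +
      c₃ • ((spInv M).map (Int.cast : ℤ → ℚ) * (humbertRatRep q * humbertRatRep q').map (Int.cast : ℤ → ℚ) *
        M.map (Int.cast : ℤ → ℚ)) := by
    rw [castQ_one, castQ_mul]
    simp only [Matrix.mul_add, Matrix.add_mul, Matrix.mul_smul, Matrix.smul_mul]
  rw [e]
  exact add_mem (add_mem (add_mem (Subalgebra.smul_mem _ (key 1 (one_mem _)) _)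
    (Subalgebra.smul_mem _ (key _ (humbertRatRep_mem_humbertPairOrder_left q q')) _))
    (Subalgebra.smul_mem _ (key _ (humbertRatRep_mem_humbertPairOrder_right q q')) _))
    (Subalgebra.smul_mem _ (key _ (humbertRatRep_mul_mem_humbertPairOrder q q')) _)

/-- **RUNGE'S CRITERION FOR A GENERAL PAIR** ("By Theorem 2 we may assume that `(α, β)` are as follows …"): if some
`M ∈ Sp₄(ℤ)` takes `q` to Humbert's normal form `q^M = (k, l, −1, 0, 0)` and the transformed second relation `q′^M` has
coprime antisymmetric-block entries `(d′, e′)`, then `ℚ(α, β) ∩ M₄(ℤ) = ℤ[α, β]` for the ORIGINAL pair.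
[cite: Runge1999EndomorphismRingsAbelianSurfaces, §6 proof of Thm. 7 (p. 295)] -/
theorem humbertPairAlgInt_eq_of_conj_normalForm (hM : IsSp M) {k l : ℤ} (hq : humbertVectorConj M q = humbertNormalForm k l)
    (hcop : IsCoprime (humbertVectorConj M q' 3) (humbertVectorConj M q' 4)) :
    humbertPairAlgInt q q' = (humbertPairOrder q q').toSubring := by
  refine le_antisymm (fun x hx ↦ ?_) (humbertPairOrder_toSubring_le_humbertPairAlgInt q q')
  have h1 := conj_mem_humbertPairAlgInt hM hx
  rw [hq] at h1
  have h2 := (mem_humbertPairAlgInt_normalForm_iff k l _ hcop).1 h1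
  rw [← hq] at h2
  exact (conj_mem_humbertPairOrder_iff hM x).1 h2

/-- For a PRIMITIVE relation `q` such an `M` exists (row A4-65, Humbert's lemma); the criterion then reads: if the
transformed `q′` has coprime `(d′, e′)`, the order of the pair is saturated. [cite: Runge1999EndomorphismRingsAbelianSurfaces, §4 p. 290 and §6 proof of Thm. 7 (p. 295)] -/
theorem humbertPairAlgInt_eq_of_isPrimitiveRel (hq : IsPrimitiveRel q)
    (hcop : ∀ M : 𝕄ℤ, IsSp M → ∀ k l : ℤ, humbertVectorConj M q = humbertNormalForm k l →
      IsCoprime (humbertVectorConj M q' 3) (humbertVectorConj M q' 4)) :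
    humbertPairAlgInt q q' = (humbertPairOrder q q').toSubring := by
  obtain ⟨k, l, -, M, hM, hqM⟩ := exists_humbertEquiv_humbertNormalForm hq
  exact humbertPairAlgInt_eq_of_conj_normalForm hM hqM (hcop M hM k l hqM)

/-- **THEOREM 7 at a simple point of `H_q ∩ H_{q′}` for a GENERAL pair** normalised by some `M ∈ Sp₄(ℤ)` with coprime
transformed `(d′, e′)`: `ρ_r(End(X_Z)) = ℤ[α, β] = ℤ ⊕ ℤα ⊕ ℤβ ⊕ ℤαβ` (row A4-66 FILE 3: `End_ℚ(X_Z) = ℚ(α, β)` for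
simple `X_Z`; FILE 2 §9 is the case `M = 1`). [cite: Runge1999EndomorphismRingsAbelianSurfaces, §6 Thm. 7 (pp. 294–295) and p. 296 ("we have `End(A_τ) = R`")] -/
theorem endRingInt_eq_humbertPairOrder_of_isSimple_of_conj {Z : siegelUpperHalfSpace 2}
    (hX : IsSimple (prinPeriod Z : (Fin 2 ⊕ Fin 2 → ℝ) ≃L[ℝ] (Fin 2 → ℂ)))
    (h₀ : Z ∈ humbertLocus (fun i ↦ (q i : ℂ))) (h₁ : Z ∈ humbertLocus (fun i ↦ (q' i : ℂ)))
    (hli : LinearIndependent ℚ ![(fun i ↦ (q i : ℚ)), (fun i ↦ (q' i : ℚ))])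
    (hM : IsSp M) {k l : ℤ} (hq : humbertVectorConj M q = humbertNormalForm k l)
    (hcop : IsCoprime (humbertVectorConj M q' 3) (humbertVectorConj M q' 4)) :
    endRingInt (prinPeriod Z : (Fin 2 ⊕ Fin 2 → ℝ) ≃L[ℝ] (Fin 2 → ℂ)) = (humbertPairOrder q q').toSubring := by
  rw [endRingInt_eq_humbertPairAlgInt_of_endAlgRat_eq (endAlgRat_eq_humbertPairAlg_of_isSimple hX h₀ h₁ hli),
    humbertPairAlgInt_eq_of_conj_normalForm hM hq hcop]

/-- The same at a point with `ρ(X_Z) = 3` (row A4-66 FILE 5). [cite: Runge1999EndomorphismRingsAbelianSurfaces, §6 Thm. 7 (pp. 294–295) and p. 296] -/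
theorem endRingInt_eq_humbertPairOrder_of_finrank_eq_three_of_conj {Z : siegelUpperHalfSpace 2}
    (h₀ : Z ∈ humbertLocus (fun i ↦ (q i : ℂ))) (h₁ : Z ∈ humbertLocus (fun i ↦ (q' i : ℂ)))
    (hli : LinearIndependent ℚ ![(fun i ↦ (q i : ℚ)), (fun i ↦ (q' i : ℚ))])
    (h3 : finrank ℤ (neronSeveriGroup (prinPeriod Z : (Fin 2 ⊕ Fin 2 → ℝ) ≃L[ℝ] (Fin 2 → ℂ))) = 3)
    (hM : IsSp M) {k l : ℤ} (hq : humbertVectorConj M q = humbertNormalForm k l)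
    (hcop : IsCoprime (humbertVectorConj M q' 3) (humbertVectorConj M q' 4)) :
    endRingInt (prinPeriod Z : (Fin 2 ⊕ Fin 2 → ℝ) ≃L[ℝ] (Fin 2 → ℂ)) = (humbertPairOrder q q').toSubring := by
  rw [endRingInt_eq_humbertPairAlgInt_of_endAlgRat_eq (endAlgRat_eq_humbertPairAlg_of_finrank_eq_three h₀ h₁ hli h3),
    humbertPairAlgInt_eq_of_conj_normalForm hM hq hcop]

end GeneralPair

/-! ## §7 "Since `Δ` is represented by `S_Δ`, it follows that `C` is contained in `H_Δ`": `H_q ∩ H_{q′} ⊆ H_{S_Δ[x,y]}(𝔥₂)` -/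

section Represented

variable {q q'}

/-- **`det S_Δ ≠ 0 ⟹ q, q′ are independent**: `xq + yq′ = 0` forces `x = y = 0`. [cite: Runge1999EndomorphismRingsAbelianSurfaces, §6 Thm. 7 (p. 294: "`S_Δ` … is positive definite")] -/
theorem eq_zero_of_smul_add_smul_eq_zero (hS : humbertInvariant q * humbertInvariant q' ≠ humbertPolar q q' ^ 2)
    {x y : ℤ} (h : x • q + y • q' = 0) : x = 0 ∧ y = 0 := by
  -- `S_Δ (x, y)ᵀ = (Δ(q, xq + yq′), Δ(q′, xq + yq′)) = 0`
  have h₁ : x * humbertInvariant q + y * humbertPolar q q' = 0 := by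
    have := humbertPolar_zero_right q
    rw [← h, humbertPolar_add_right, humbertPolar_smul_right, humbertPolar_smul_right, humbertPolar_self] at this
    linarith
  have h₂ : x * humbertPolar q q' + y * humbertInvariant q' = 0 := by
    have := humbertPolar_zero_right q'
    rw [← h, humbertPolar_add_right, humbertPolar_smul_right, humbertPolar_smul_right, humbertPolar_self,
      humbertPolar_comm] at this
    linarith
  -- Cramer: `det(S_Δ)·x = det(S_Δ)·y = 0`
  have hx : (humbertInvariant q * humbertInvariant q' - humbertPolar q q' ^ 2) * x = 0 := by
    linear_combination humbertInvariant q' * h₁ - humbertPolar q q' * h₂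
  have hy : (humbertInvariant q * humbertInvariant q' - humbertPolar q q' ^ 2) * y = 0 := by
    linear_combination humbertInvariant q * h₂ - humbertPolar q q' * h₁
  have hd : humbertInvariant q * humbertInvariant q' - humbertPolar q q' ^ 2 ≠ 0 := sub_ne_zero.2 hS
  exact ⟨(mul_eq_zero.1 hx).resolve_left hd, (mul_eq_zero.1 hy).resolve_left hd⟩

/-- `xq + yq′ ≠ 0` for `(x, y) ≠ (0, 0)` when `det S_Δ ≠ 0`. [cite: Runge1999EndomorphismRingsAbelianSurfaces, §6 Thm. 7 (p. 294)] -/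
theorem smul_add_smul_ne_zero (hS : humbertInvariant q * humbertInvariant q' ≠ humbertPolar q q' ^ 2) {x y : ℤ}
    (hxy : x ≠ 0 ∨ y ≠ 0) : x • q + y • q' ≠ 0 := by
  intro h
  obtain ⟨hx, hy⟩ := eq_zero_of_smul_add_smul_eq_zero hS h
  exact hxy.elim (fun h' ↦ h' hx) (fun h' ↦ h' hy)

/-- **If `S_Δ` represents `Δ₀` by `(x, y)` with `xq + yq′ ≠ 0`, then `H_q ∩ H_{q′} ⊆ H_{Δ₀}(𝔥₂)`**: every point of the
intersection satisfies the singular relation `xq + yq′` of invariant `S_Δ[x, y] = Δ₀` (Runge, proof of Cor. 9: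
"Since `Δ` is represented by `S_Δ`, it follows that `C` is contained in `H_Δ`"; B–W (11)).
[cite: Runge1999EndomorphismRingsAbelianSurfaces, §6 proof of Cor. 9 (p. 296)] [cite: BirkenhakeWilhelm2003, §4 eq. (11) (p. 1830)] -/
theorem inter_humbertLocus_subset_humbertLocusOfInvariant {x y : ℤ} (hne : x • q + y • q' ≠ 0) :
    humbertLocus (fun i ↦ (q i : ℂ)) ∩ humbertLocus (fun i ↦ (q' i : ℂ)) ⊆
      humbertLocusOfInvariant (discForm₂ q q' x y) := by
  rintro Z ⟨h₀, h₁⟩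
  rw [mem_humbertLocusOfInvariant_iff]
  exact ⟨x • q + y • q', hne, (discForm₂_eq_humbertInvariant q q' x y).symm, mem_humbertLocus_smul_add_smul h₀ h₁ x y⟩

/-- The same for `det S_Δ ≠ 0` and `(x, y) ≠ (0, 0)` — in particular for every PRIMITIVE representation (`x, y` coprime)
as in Cor. 9 (i). [cite: Runge1999EndomorphismRingsAbelianSurfaces, §6 proof of Cor. 9 (p. 296)] -/
theorem inter_humbertLocus_subset_humbertLocusOfInvariant_of_ne
    (hS : humbertInvariant q * humbertInvariant q' ≠ humbertPolar q q' ^ 2) {x y : ℤ} (hxy : x ≠ 0 ∨ y ≠ 0) {Δ₀ : ℤ}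
    (hΔ : discForm₂ q q' x y = Δ₀) :
    humbertLocus (fun i ↦ (q i : ℂ)) ∩ humbertLocus (fun i ↦ (q' i : ℂ)) ⊆ humbertLocusOfInvariant Δ₀ := by
  rw [← hΔ]
  exact inter_humbertLocus_subset_humbertLocusOfInvariant (smul_add_smul_ne_zero hS hxy)

/-- Coprime `(x, y)` are not both zero. [folklore] -/
private theorem ne_zero_or_ne_zero_of_isCoprime {x y : ℤ} (h : IsCoprime x y) : x ≠ 0 ∨ y ≠ 0 := by
  by_contra hxy
  simp only [not_or, not_not] at hxy
  rw [hxy.1, hxy.2] at h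
  exact not_isCoprime_zero_zero h

/-- **Cor. 9 (i) ⟹ "`⊂ H_Δ`" on `𝔥₂`**: if `Δ₀` is primitively represented by `S_Δ` (`det S_Δ ≠ 0`), then
`H_q ∩ H_{q′} ⊆ H_{Δ₀}(𝔥₂)` (the relation `xq + yq′` need not be a primitive vector; `H_{Δ₀}(𝔥₂)` is the union over all
non-zero relations of invariant `Δ₀`). [cite: Runge1999EndomorphismRingsAbelianSurfaces, §6 Cor. 9 (i) ⟹ (iii), proof p. 296] -/
theorem inter_humbertLocus_subset_humbertLocusOfInvariant_of_primitively_represented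
    (hS : humbertInvariant q * humbertInvariant q' ≠ humbertPolar q q' ^ 2) {Δ₀ : ℤ}
    (h : ∃ x y : ℤ, IsCoprime x y ∧ discForm₂ q q' x y = Δ₀) :
    humbertLocus (fun i ↦ (q i : ℂ)) ∩ humbertLocus (fun i ↦ (q' i : ℂ)) ⊆ humbertLocusOfInvariant Δ₀ := by
  obtain ⟨x, y, hcop, hΔ⟩ := h
  exact inter_humbertLocus_subset_humbertLocusOfInvariant_of_ne hS (ne_zero_or_ne_zero_of_isCoprime hcop) hΔ

end Represented

end SiegelModuli

end Literature.AlgebraicGeometry.ModuliOfAbelianVarieties
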